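import Summits.RiemannHypothesis.RiemannHypothesis.Theorems.WeilBochnerMeasureCountingPrelim
import Summits.RiemannHypothesis.RiemannHypothesis.Theorems.WeilBochnerRepresentationRungs
import HarnessLib

/-!
# RiemannHypothesis — the Riemann–von Mangoldt counting law of every Bochner–Kreĭn measure

Helper file (`--supports stmt-RiemannHypothesis-0098`), RH-free, standard axioms.  Seat rh-explicit
weil-3 (structure).

Let `μ` be ANY positive measure on `ℝ` representing Weil's form on a window `[-b, b]`, `b > 0`
(`‖ĝ(½+it)‖² ∈ L¹(μ)` and `W(g ⋆ g̃) = ∫ ‖ĝ(½+it)‖² dμ` for all smooth tests `g` supported in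
`[-b, b]` — hypothesis `hμ`, the conclusion of
`Literature.NumberTheory.LFunctions.WeilBochner.exists_measure_of_weilPositivityOn`; such a `μ` exists iff
`WeilPositivityOn b`, unconditionally for `b ≤ 4023/5000`, and under RH the zero-counting measure
`Σ_ρ m_ρ δ_{Im ρ}` serves every `b`).  THEN `μ` OBEYS THE RIEMANN–VON MANGOLDT FORMULA:

* `abs_measureReal_Icc_sub_theta_le`: there is `C` with
  **`|μ[0, T] − θ(T)/π| ≤ C (1 + log(1 + T))` and `|μ[-T, 0] − θ(T)/π| ≤ C (1 + log(1 + T))` for all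
  `T ≥ 0`**, `θ = riemannSiegelTheta` (Backlund's main term; `θ(T)/π = (T/2π) log(T/2πe) − 1/8 + O(1/T)`);
* `abs_measureReal_Icc_symm_sub_le`: `|μ[-T, T] − 2θ(T)/π| ≤ C (1 + log(1 + T))`;
* `measure_Icc_lt_top`: `μ` is locally finite on intervals; `measureReal_Icc_short_le`: the local
  density bound `μ[T, T + 1] ≤ C (1 + log(2 + |T|))`;
* `exists_measure_countingLaw_8046`: unconditionally there is a positive measure on the critical line
  reproducing the explicit formula on all test autocorrelations of prime-side bandwidth `2 · 4023/5000`
  whose counting function is `θ(T)/π + O(log T)` on both half-lines.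

So window positivity at ONE prime-side resolution pins every representing measure to the zero-counting
function of `ζ` with von Mangoldt precision `O(log T)`; the earlier growth laws (`measure_Icc_le`,
`measure_Icc_ge`) had the order `T log T` with non-matching constants.  Under RH, `μ = Σ_ρ m_ρ δ_{Im ρ}`
and `μ[0, T] = N(T)`: the theorem specialises to Backlund's `N(T) = θ(T)/π + O(log T)`.

Proof.  With `2πΔ = min b (log 2)`, Selberg's majorant/minorant `F±` of `𝟙_{[0,T]}` of bandwidth `Δ`
are the transforms of continuous kernels `g±` supported in `[-2πΔ, 2πΔ]` (`exists_selberg_kernels`);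
`∫ F₊ dμ = W(g₊)` and `∫ (F₊ − F₋) dμ = W(g₊ − g₋)` by `weilFunctional_kernel_eq_integral` (both
transforms are nonnegative), so `∫ F₋ dμ = W(g₋)` by additivity, and `W(g₋) ≤ μ[0, T] ≤ W(g₊)`; on the
Weil side `|W(g±) − θ(T)/π| ≤ A + B log(1 + T)` (`exists_weil_side_bound`).  `[-T, 0]` is `[0, T]` for
the reflected measure (`represents_map_neg`).
-/

noncomputable section

set_option linter.dupNamespace false  -- the mandated namespace repeats `RiemannHypothesis`

open Complex Filter Set MeasureTheory
open scoped Real Topology ContDiff ComplexConjugate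
open Literature.NumberTheory.LFunctions Literature.Analysis.Fourier Literature.Analysis.SpecialFunctions

namespace Summit.RiemannHypothesis.RiemannHypothesis.Theorems.WeilBochnerMeasure

variable {b : ℝ} {μ : Measure ℝ}

/-! ## The counting law on `[0, T]` -/

/-- **Core of the counting law on `[0, T]`.**  If `μ` represents Weil's form on `[-b, b]` (`b > 0`) then
there is `C` with `μ[0, T] < ∞` and `|μ[0, T] − θ(T)/π| ≤ C (1 + log(1 + T))` for all `T ≥ 0`. -/
theorem abs_measureReal_Icc_zero_sub_theta_le (hb : 0 < b)
    (hμ : ∀ g : ℝ → ℂ, IsWeilTest g → tsupport g ⊆ Icc (-b) b →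
      Integrable (fun t : ℝ ↦ ‖weilMellin g (1 / 2 + t * I)‖ ^ 2) μ ∧
        weilQuadratic g = ((∫ t, ‖weilMellin g (1 / 2 + t * I)‖ ^ 2 ∂μ : ℝ) : ℂ)) :
    ∃ C : ℝ, ∀ T : ℝ, 0 ≤ T → μ (Icc 0 T) < ⊤ ∧
      |μ.real (Icc 0 T) - riemannSiegelTheta T / π| ≤ C * (1 + Real.log (1 + T)) := by
  -- bandwidth `2πΔ = c = min b (log 2)`
  set c : ℝ := min b (Real.log 2) with hc
  have hc0 : 0 < c := lt_min hb (Real.log_pos one_lt_two)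
  have hcb : c ≤ b := min_le_left _ _
  have hc2 : c ≤ Real.log 2 := min_le_right _ _
  have hclt : c < 2 * b := by linarith
  set Δ : ℝ := c / (2 * π) with hΔ
  have hΔ0 : 0 < Δ := by positivity
  have h2πΔ : 2 * π * Δ = c := by
    rw [hΔ]; field_simp
  obtain ⟨A, B, hAB⟩ := exists_weil_side_bound hΔ0 (by rw [h2πΔ]; exact hc2)
  refine ⟨max A B, fun T hT ↦ ?_⟩
  obtain ⟨gp, gm, hgpc, hgmc, hgps, hgms, hgpM, hgmM, hgp0, hgm0⟩ := exists_selberg_kernels hΔ0 hT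
  -- Weil side
  have hp := hAB T hT gp hgpc hgps (Or.inl ⟨hgpM, hgp0⟩)
  have hm := hAB T hT gm hgmc hgms (Or.inr ⟨hgmM, hgm0⟩)
  rw [h2πΔ] at hgps hgms
  -- real transforms on the line
  set Fp : ℝ → ℝ := selbergMajorantReal Δ 0 T with hFp
  set Fm : ℝ → ℝ := selbergMinorantReal Δ 0 T with hFm
  have hgp_line : ∀ u : ℝ, weilMellin gp (1 / 2 + u * I) = (Fp u : ℂ) := fun u ↦ by
    rw [hgpM, selbergMajorant_ofReal]
  have hgm_line : ∀ u : ℝ, weilMellin gm (1 / 2 + u * I) = (Fm u : ℂ) := fun u ↦ by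
    rw [hgmM, selbergMinorant_ofReal]
  have hgpcs : HasCompactSupport gp := isCompact_Icc.of_isClosed_subset (isClosed_tsupport _) hgps
  have hgmcs : HasCompactSupport gm := isCompact_Icc.of_isClosed_subset (isClosed_tsupport _) hgms
  -- quadratic decay of the transforms
  obtain ⟨Kp, hKp0, hKp⟩ := exists_norm_selbergMajorant_le hΔ0 0 T
  obtain ⟨Km, hKm0, hKm⟩ := exists_norm_selbergMinorant_le hΔ0 0 T
  have hdecp : ∀ u : ℝ, ‖weilMellin gp (1 / 2 + u * I)‖ ≤ Kp * (1 + 2 * (1 + T ^ 2)) / (1 + u ^ 2) :=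
    fun u ↦ by
      rw [hgpM]
      have h := hKp u
      simp only [Complex.ofReal_im, abs_zero, mul_zero, Real.exp_zero, mul_one, Complex.ofReal_re] at h
      exact h.trans (profile_le_div hKp0.le)
  have hdecm : ∀ u : ℝ, ‖weilMellin gm (1 / 2 + u * I)‖ ≤ Km * (1 + 2 * (1 + T ^ 2)) / (1 + u ^ 2) :=
    fun u ↦ by
      rw [hgmM]
      have h := hKm u
      simp only [Complex.ofReal_im, abs_zero, mul_zero, Real.exp_zero, mul_one, Complex.ofReal_re] at h
      exact h.trans (profile_le_div hKm0.le)
  -- the difference kernel `hd = gp - gm`, transform `Fp - Fm ≥ 0`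
  set hd : ℝ → ℂ := fun x ↦ gp x - gm x with hhd
  have hhdc : Continuous hd := hgpc.sub hgmc
  have hhds : tsupport hd ⊆ Icc (-c) c := by
    refine closure_minimal (fun x hx ↦ ?_) isClosed_Icc
    rw [Function.mem_support] at hx
    by_contra hxc
    have h1 : gp x = 0 := image_eq_zero_of_notMem_tsupport fun h ↦ hxc (hgps h)
    have h2 : gm x = 0 := image_eq_zero_of_notMem_tsupport fun h ↦ hxc (hgms h)
    exact hx (by simp only [hhd, h1, h2, sub_zero])
  have hhdcs : HasCompactSupport hd := isCompact_Icc.of_isClosed_subset (isClosed_tsupport _) hhds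
  have hsum : gm + hd = gp := by
    funext x; simp only [Pi.add_apply, hhd]; ring
  have hhd_line : ∀ u : ℝ, weilMellin hd (1 / 2 + u * I) = ((Fp u - Fm u : ℝ) : ℂ) := by
    intro u
    have h := weilMellin_add hgmc hgmcs hhdc hhdcs (1 / 2 + u * I)
    rw [hsum, hgp_line, hgm_line] at h
    push_cast
    linear_combination -h
  have hdech : ∀ u : ℝ, ‖weilMellin hd (1 / 2 + u * I)‖ ≤
      (Kp + Km) * (1 + 2 * (1 + T ^ 2)) / (1 + u ^ 2) := by
    intro u
    have e : weilMellin hd (1 / 2 + u * I) =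
        weilMellin gp (1 / 2 + u * I) - weilMellin gm (1 / 2 + u * I) := by
      rw [hhd_line, hgp_line, hgm_line]; push_cast; ring
    rw [e]
    calc ‖weilMellin gp (1 / 2 + u * I) - weilMellin gm (1 / 2 + u * I)‖
        ≤ ‖weilMellin gp (1 / 2 + u * I)‖ + ‖weilMellin gm (1 / 2 + u * I)‖ := norm_sub_le _ _
      _ ≤ Kp * (1 + 2 * (1 + T ^ 2)) / (1 + u ^ 2) + Km * (1 + 2 * (1 + T ^ 2)) / (1 + u ^ 2) :=
          add_le_add (hdecp u) (hdecm u)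
      _ = (Kp + Km) * (1 + 2 * (1 + T ^ 2)) / (1 + u ^ 2) := by ring
  -- signs: `Fm ≤ 𝟙_{[0,T]} ≤ Fp`
  set χ : ℝ → ℝ := (Icc 0 T).indicator (fun _ ↦ (1 : ℝ)) with hχ
  have hind_le : ∀ u, χ u ≤ Fp u := fun u ↦ indicator_le_selbergMajorantReal hΔ0 hT u
  have hle_ind : ∀ u, Fm u ≤ χ u := fun u ↦ selbergMinorantReal_le_indicator_Icc hΔ0 0 T u
  have hχ0 : ∀ u, 0 ≤ χ u := fun u ↦ Set.indicator_nonneg (fun _ _ ↦ zero_le_one) u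
  have hFp0 : ∀ u, 0 ≤ Fp u := fun u ↦ (hχ0 u).trans (hind_le u)
  have hFpm0 : ∀ u, 0 ≤ Fp u - Fm u := fun u ↦ by linarith [hind_le u, hle_ind u]
  -- measure side: `∫ Fp dμ = W(gp)`, `∫ (Fp - Fm) dμ = W(hd)`
  obtain ⟨hIp, hWp⟩ := weilFunctional_kernel_eq_integral hb hμ hgpc hclt hgps hdecp
    (fun u ↦ by rw [hgp_line]; exact ⟨Complex.ofReal_im _, by rw [Complex.ofReal_re]; exact hFp0 u⟩)
  obtain ⟨hId, hWd⟩ := weilFunctional_kernel_eq_integral hb hμ hhdc hclt hhds hdech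
    (fun u ↦ by rw [hhd_line]; exact ⟨Complex.ofReal_im _, by rw [Complex.ofReal_re]; exact hFpm0 u⟩)
  simp only [hgp_line, Complex.ofReal_re] at hIp hWp
  simp only [hhd_line, Complex.ofReal_re] at hId hWd
  -- `W(gp) = W(gm) + W(hd)`, hence `Re W(gm) = ∫ Fm dμ`
  have hAm := integrable_arch_of_decay hgmc hgmcs hdecm
  have hAd := integrable_arch_of_decay hhdc hhdcs hdech
  have hWadd : weilFunctional gp = weilFunctional gm + weilFunctional hd := by
    rw [← hsum]; exact weilFunctional_add_of_continuous hgmc hgmcs hhdc hhdcs hAm hAd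
  have hIm : Integrable Fm μ :=
    (hIp.sub hId).congr (ae_of_all _ fun t ↦ by simp only [Pi.sub_apply]; ring)
  have hWm_re : (weilFunctional gm).re = ∫ t, Fm t ∂μ := by
    have h : weilFunctional gm = weilFunctional gp - weilFunctional hd := by rw [hWadd]; ring
    rw [h, hWp, hWd, ← Complex.ofReal_sub, Complex.ofReal_re, ← integral_sub hIp hId]
    exact integral_congr_ae (ae_of_all _ fun t ↦ by ring)
  have hWp_re : (weilFunctional gp).re = ∫ t, Fp t ∂μ := by rw [hWp, Complex.ofReal_re]
  -- the indicator is integrable and integrates to `μ[0, T]`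
  have hχm : AEStronglyMeasurable χ μ :=
    (measurable_const.indicator measurableSet_Icc).aestronglyMeasurable
  have hχi : Integrable χ μ := hIp.mono' hχm (ae_of_all _ fun t ↦ by
    rw [Real.norm_eq_abs, abs_of_nonneg (hχ0 t)]; exact hind_le t)
  have hχint : ∫ t, χ t ∂μ = μ.real (Icc 0 T) := integral_indicator_one measurableSet_Icc
  have hfin : μ (Icc 0 T) < ⊤ := by
    refine lt_of_le_of_lt (measure_mono fun t ht ↦ ?_) (hIp.measure_norm_ge_lt_top zero_lt_one)
    have h := hind_le t
    simp only [hχ, indicator_of_mem ht] at h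
    show (1 : ℝ) ≤ ‖Fp t‖
    rw [Real.norm_eq_abs, abs_of_nonneg (hFp0 t)]
    exact h
  -- squeeze
  have hup : μ.real (Icc 0 T) ≤ (weilFunctional gp).re := by
    rw [hWp_re, ← hχint]; exact integral_mono hχi hIp hind_le
  have hlow : (weilFunctional gm).re ≤ μ.real (Icc 0 T) := by
    rw [hWm_re, ← hχint]; exact integral_mono hIm hχi hle_ind
  refine ⟨hfin, ?_⟩
  have hlogT : 0 ≤ Real.log (1 + T) := Real.log_nonneg (by linarith)
  have hA : A ≤ max A B := le_max_left _ _
  have hB : B * Real.log (1 + T) ≤ max A B * Real.log (1 + T) :=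
    mul_le_mul_of_nonneg_right (le_max_right _ _) hlogT
  rw [abs_le] at hp hm ⊢
  constructor <;> nlinarith [hp.1, hp.2, hm.1, hm.2]

/-- **The Riemann–von Mangoldt counting law of a representing measure (both half-lines).**  If `μ`
represents Weil's form on `[-b, b]` (`b > 0`), there is `C` such that for all `T ≥ 0`
`|μ[0, T] − θ(T)/π| ≤ C (1 + log(1 + T))` and `|μ[-T, 0] − θ(T)/π| ≤ C (1 + log(1 + T))`
(`θ = riemannSiegelTheta`; the second from the first for the reflected measure). -/
theorem abs_measureReal_Icc_sub_theta_le (hb : 0 < b)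
    (hμ : ∀ g : ℝ → ℂ, IsWeilTest g → tsupport g ⊆ Icc (-b) b →
      Integrable (fun t : ℝ ↦ ‖weilMellin g (1 / 2 + t * I)‖ ^ 2) μ ∧
        weilQuadratic g = ((∫ t, ‖weilMellin g (1 / 2 + t * I)‖ ^ 2 ∂μ : ℝ) : ℂ)) :
    ∃ C : ℝ, ∀ T : ℝ, 0 ≤ T →
      |μ.real (Icc 0 T) - riemannSiegelTheta T / π| ≤ C * (1 + Real.log (1 + T)) ∧
        |μ.real (Icc (-T) 0) - riemannSiegelTheta T / π| ≤ C * (1 + Real.log (1 + T)) := by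
  obtain ⟨C₁, hC₁⟩ := abs_measureReal_Icc_zero_sub_theta_le hb hμ
  obtain ⟨C₂, hC₂⟩ := abs_measureReal_Icc_zero_sub_theta_le hb (represents_map_neg hμ)
  refine ⟨max C₁ C₂, fun T hT ↦ ⟨?_, ?_⟩⟩
  · have h := (hC₁ T hT).2
    have hlogT : 0 ≤ 1 + Real.log (1 + T) := by
      have := Real.log_nonneg (by linarith : (1 : ℝ) ≤ 1 + T); linarith
    exact h.trans (mul_le_mul_of_nonneg_right (le_max_left _ _) hlogT)
  · have h := (hC₂ T hT).2
    rw [map_neg_measureReal_Icc] at h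
    have hlogT : 0 ≤ 1 + Real.log (1 + T) := by
      have := Real.log_nonneg (by linarith : (1 : ℝ) ≤ 1 + T); linarith
    exact h.trans (mul_le_mul_of_nonneg_right (le_max_right _ _) hlogT)

/-- **Local finiteness.**  A representing measure gives finite mass to every bounded interval. -/
theorem measure_Icc_lt_top (hb : 0 < b)
    (hμ : ∀ g : ℝ → ℂ, IsWeilTest g → tsupport g ⊆ Icc (-b) b →
      Integrable (fun t : ℝ ↦ ‖weilMellin g (1 / 2 + t * I)‖ ^ 2) μ ∧
        weilQuadratic g = ((∫ t, ‖weilMellin g (1 / 2 + t * I)‖ ^ 2 ∂μ : ℝ) : ℂ))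
    (T₁ T₂ : ℝ) : μ (Icc T₁ T₂) < ⊤ := by
  obtain ⟨C₁, hC₁⟩ := abs_measureReal_Icc_zero_sub_theta_le hb hμ
  obtain ⟨C₂, hC₂⟩ := abs_measureReal_Icc_zero_sub_theta_le hb (represents_map_neg hμ)
  set S : ℝ := max |T₁| |T₂| with hS
  have hS0 : 0 ≤ S := le_trans (abs_nonneg _) (le_max_left _ _)
  have h1 := (hC₁ S hS0).1
  have h2 := (hC₂ S hS0).1
  rw [Measure.map_apply measurable_neg measurableSet_Icc] at h2
  have hpre : (fun t : ℝ ↦ -t) ⁻¹' Icc 0 S = Icc (-S) 0 := by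
    ext t; simp only [mem_preimage, mem_Icc]; constructor <;> intro h <;> constructor <;> linarith [h.1, h.2]
  rw [hpre] at h2
  have hsub : Icc T₁ T₂ ⊆ Icc (-S) 0 ∪ Icc 0 S := by
    intro t ht
    rcases le_or_gt 0 t with h0 | h0
    · exact Or.inr ⟨h0, ht.2.trans ((le_abs_self _).trans (le_max_right _ _))⟩
    · refine Or.inl ⟨?_, h0.le⟩
      have : -S ≤ T₁ := by
        have := neg_abs_le T₁; have := le_max_left |T₁| |T₂|; linarith
      exact this.trans ht.1
  exact lt_of_le_of_lt (measure_mono hsub) ((measure_union_le _ _).trans_lt (ENNReal.add_lt_top.2 ⟨h2, h1⟩))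

/-- **Symmetric intervals: `|μ[-T, T] − 2θ(T)/π| ≤ C (1 + log(1 + T))`.** -/
theorem abs_measureReal_Icc_symm_sub_le (hb : 0 < b)
    (hμ : ∀ g : ℝ → ℂ, IsWeilTest g → tsupport g ⊆ Icc (-b) b →
      Integrable (fun t : ℝ ↦ ‖weilMellin g (1 / 2 + t * I)‖ ^ 2) μ ∧
        weilQuadratic g = ((∫ t, ‖weilMellin g (1 / 2 + t * I)‖ ^ 2 ∂μ : ℝ) : ℂ)) :
    ∃ C : ℝ, ∀ T : ℝ, 0 ≤ T →
      |μ.real (Icc (-T) T) - 2 * riemannSiegelTheta T / π| ≤ C * (1 + Real.log (1 + T)) := by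
  obtain ⟨C, hC⟩ := abs_measureReal_Icc_sub_theta_le hb hμ
  -- `C ≥ 0` and `μ[0, 0] ≤ C` from `T = 0`
  have h00 := (hC 0 le_rfl).1
  simp only [riemannSiegelTheta_zero, zero_div, sub_zero, add_zero, Real.log_one, mul_one] at h00
  have hC0 : 0 ≤ C := (abs_nonneg _).trans h00
  have hμ00 : μ.real (Icc 0 0) ≤ C := (le_abs_self _).trans h00
  refine ⟨3 * C, fun T hT ↦ ?_⟩
  obtain ⟨h1, h2⟩ := hC T hT
  have hlog : 0 ≤ Real.log (1 + T) := Real.log_nonneg (by linarith)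
  -- `μ[-T, T] + μ{0} = μ[-T, 0] + μ[0, T]`
  have hunion : Icc (-T) 0 ∪ Icc 0 T = Icc (-T) T := Icc_union_Icc_eq_Icc (by linarith) hT
  have hinter : Icc (-T) 0 ∩ Icc 0 T = Icc 0 0 := by
    ext t; simp only [mem_inter_iff, mem_Icc]; constructor
    · rintro ⟨⟨_, h⟩, ⟨h', _⟩⟩; exact ⟨h', h⟩
    · rintro ⟨h, h'⟩; exact ⟨⟨by linarith, h'⟩, ⟨h, by linarith⟩⟩
  have hfin1 : μ (Icc (-T) 0) ≠ ⊤ := (measure_Icc_lt_top hb hμ _ _).ne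
  have hfin2 : μ (Icc 0 T) ≠ ⊤ := (measure_Icc_lt_top hb hμ _ _).ne
  have hkey : μ.real (Icc (-T) T) + μ.real (Icc 0 0) = μ.real (Icc (-T) 0) + μ.real (Icc 0 T) := by
    rw [← hunion, ← hinter]
    exact measureReal_union_add_inter measurableSet_Icc hfin1 hfin2
  have hnn : 0 ≤ μ.real (Icc 0 0) := measureReal_nonneg
  have hCl : 0 ≤ C * Real.log (1 + T) := mul_nonneg hC0 hlog
  rw [mul_div_assoc]
  rw [abs_le] at h1 h2 ⊢
  constructor <;> linarith [h1.1, h1.2, h2.1, h2.2]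

/-- **Local density bound: `μ[T, T + 1] ≤ C (1 + log(2 + |T|))`** for every representing measure
(difference of the counting law at `|T| + 1` and the monotonicity of `μ`; `θ` is `½`-Lipschitz up to a
logarithm is NOT used — the crude form `μ[T, T+1] ≤ μ[-(|T|+1), |T|+1]` minus nothing suffices only for an
`O(T log T)` bound, so we subtract the two counting laws on `[0, |T|+1]` and `[0, ·]` instead). -/
theorem measureReal_Icc_short_le (hb : 0 < b)
    (hμ : ∀ g : ℝ → ℂ, IsWeilTest g → tsupport g ⊆ Icc (-b) b →
      Integrable (fun t : ℝ ↦ ‖weilMellin g (1 / 2 + t * I)‖ ^ 2) μ ∧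
        weilQuadratic g = ((∫ t, ‖weilMellin g (1 / 2 + t * I)‖ ^ 2 ∂μ : ℝ) : ℂ)) :
    ∃ C : ℝ, ∀ T : ℝ, 0 ≤ T →
      μ.real (Ioc T (T + 1)) ≤ C * (1 + Real.log (2 + T)) +
        (riemannSiegelTheta (T + 1) - riemannSiegelTheta T) / π := by
  obtain ⟨C, hC⟩ := abs_measureReal_Icc_sub_theta_le hb hμ
  refine ⟨2 * C, fun T hT ↦ ?_⟩
  have h1 := (hC T hT).1
  have h2 := (hC (T + 1) (by linarith)).1
  have hfin : μ (Icc 0 T) ≠ ⊤ := (measure_Icc_lt_top hb hμ _ _).ne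
  have hfin' : μ (Ioc T (T + 1)) ≠ ⊤ :=
    (lt_of_le_of_lt (measure_mono Ioc_subset_Icc_self) (measure_Icc_lt_top hb hμ _ _)).ne
  have hsplit : μ.real (Icc 0 (T + 1)) = μ.real (Icc 0 T) + μ.real (Ioc T (T + 1)) := by
    rw [← Icc_union_Ioc_eq_Icc hT (by linarith)]
    exact measureReal_union (Set.disjoint_left.2 fun t ht ht' ↦ by
      simp only [mem_Icc, mem_Ioc] at ht ht'; linarith [ht.2, ht'.1]) measurableSet_Ioc hfin hfin'
  have hlog1 : Real.log (1 + T) ≤ Real.log (2 + T) := Real.log_le_log (by linarith) (by linarith)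
  have hlog2 : Real.log (1 + (T + 1)) = Real.log (2 + T) := by ring_nf
  have hlog0 : 0 ≤ Real.log (1 + T) := Real.log_nonneg (by linarith)
  have hC0 : 0 ≤ C := by
    have h00 := (hC 0 le_rfl).1
    simp only [riemannSiegelTheta_zero, zero_div, sub_zero, add_zero, Real.log_one, mul_one] at h00
    exact (abs_nonneg _).trans h00
  rw [hlog2] at h2
  rw [sub_div]
  have hCl : C * Real.log (1 + T) ≤ C * Real.log (2 + T) := mul_le_mul_of_nonneg_left hlog1 hC0
  rw [abs_le] at h1 h2
  linarith [h1.1, h1.2, h2.1, h2.2]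

/-! ## The unconditional instance at the frontier rung -/

/-- **Unconditional: a positive measure on the critical line with the Riemann–von Mangoldt counting law.**
There is a positive regular Borel measure `μ` on `ℝ` which reproduces Weil's explicit-formula functional
on every autocorrelation `g ⋆ g̃` of a smooth test supported in `[-4023/5000, 4023/5000]`
(`W(g ⋆ g̃) = ∫ ‖ĝ(½+it)‖² dμ`; from the tree's rung `WeilPositivityOn (4023/5000)`) and whose
counting function satisfies `|μ[0, T] − θ(T)/π|, |μ[-T, 0] − θ(T)/π| ≤ C (1 + log(1 + T))` for all
`T ≥ 0` — the zero-counting asymptotics of `ζ` without any hypothesis on the zeros. -/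
theorem exists_measure_countingLaw_8046 :
    ∃ μ : Measure ℝ, μ.Regular ∧
      (∀ g : ℝ → ℂ, IsWeilTest g → tsupport g ⊆ Icc (-(4023 / 5000 : ℝ)) (4023 / 5000) →
        Integrable (fun t : ℝ ↦ ‖weilMellin g (1 / 2 + t * I)‖ ^ 2) μ ∧
          weilQuadratic g = ((∫ t, ‖weilMellin g (1 / 2 + t * I)‖ ^ 2 ∂μ : ℝ) : ℂ)) ∧
      ∃ C : ℝ, ∀ T : ℝ, 0 ≤ T →
        |μ.real (Icc 0 T) - riemannSiegelTheta T / π| ≤ C * (1 + Real.log (1 + T)) ∧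
          |μ.real (Icc (-T) 0) - riemannSiegelTheta T / π| ≤ C * (1 + Real.log (1 + T)) := by
  obtain ⟨μ, hreg, hμ⟩ := WeilBochnerRungs.exists_measure_8046
  exact ⟨μ, hreg, hμ, abs_measureReal_Icc_sub_theta_le (by norm_num) hμ⟩

end Summit.RiemannHypothesis.RiemannHypothesis.Theorems.WeilBochnerMeasure

end
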